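import Mathlib
import Summits.Ventures.FusionMHD.Models.RwmFRS1Solution
import HarnessLib

/-!
# F3.r4 instance «RwmFRS1» (row «F3.r4-FRS1-RWM31»): THE FOUR SENTENCES — no-wall instability of the external `(3,1)`
# mode, the ideal-wall window, the critical wall factor, and the certified thin-wall RWM growth rate

Assembly file (model-6 g6) of the F3.r4 chain `RwmFRS1` → `RwmFRS1Axis` → `RwmFRS1AxisJets` → `RwmFRS1Chain` →
`RwmFRS1Solution` (the axis-regular marginal solution `ξ₁ = xi`, `C¹` through the axis, no zero on `(0, a]`,
`14.3046191 < L = aξ₁′/ξ₁(a) < 14.3046192`). It COMPOSES three typed pieces of the tree BY NAME: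
* lit-4's PROVED external-mode test `ScrewPinch.Profile.newcombExternalModes_iff` [Freidberg2014 §11.5.3 (11.117)–(11.118)]
  and `fluidEnergy_eq_boundary_of_solution` — so the reference energies `δW_∞`, `δW_b` of (11.148)–(11.149) ARE the
  external energies `externalEnergy 3 k 1 Λ ξ₁` of the marginal solution, `= δŴ(L, Λ)·ξ₁(1)²`
  (`externalEnergy_xi`; `δŴ(L, Λ) = (L − 29)/44296 + Λ/14700`, `RwmFRS1.boundaryForm_eq`);
* lit-3's wall factors `ScrewPinch.Vacuum.wallFactorInf` / `wallFactor` [(11.96), (11.150)] with `m/(m+ζ_a) ≤ Λ_∞ < 1`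
  (§8), the §9 bracket lemmas fed — exactly as in lit-3's worked template §11 — with the tree's elementary enclosures
  `firstTwoTerms_le_besselI` / `besselI_le_firstTerm_div` (I-side), `le_besselKReal_add_two` / `besselKReal_add_three_le`
  / `besselKReal_two_mem_Icc` (K-side): **`6.847 ≤ Λ_b(ζ_a = 1/5, ζ_b = 21/100) ≤ 6.851`**,
  **`Λ_b(1/5, 11/50) ≤ 3.576`**, and `0.99666 ≤ Λ_∞(1/5) ≤ 0.9967` (ratio form `lambdaInf_eq_ratio`);
* model-6's `ResistiveWall.IsThinWallRate` [(11.169)] for the rate.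

CERTIFIED SENTENCES (MODEL M_RWM = FRS1 screw pinch `TearingFRS1.Sigma.dyn` + vacuum + thin resistive wall, `R₀ = 5a`
DECLARED; wall radii `b = 21/20·a`, `11/10·a` are DECLARED SYNTHETIC; CLASS C = external `(m,n) = (3,1)`; MODELLED caveat
W6 verbatim: the FRS1 data are reduced-MHD data (`B_z ≡ 1`, `p ≡ 0` with `B_θ ≠ 0`), not an exact force-balanced ideal
equilibrium — `B_z` deficit ≤ 0.77 % at `r = a`):
1. `lambdaCrit_bounds` — the critical wall factor `Λ_crit = (29 − L)·14700/44296 ∈ (4.87678, 4.87679)`;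
2. **`dWinf_neg`**, **`noWall_not_stable`** — `δW_∞ < 0`: WITHOUT a wall the marginal solution `ξ₁` is an admissible
   displacement of negative energy, so NOT every admissible displacement has positive energy (the external `(3,1)` kink
   side of M_RWM; tokamak band (11.221) `2.672 < nq_a = 2.8 < 3` agrees, VALIDATED);
3. **`dWb_pos`**, **`idealWall_stable`** (`b = 21/20·a`): `δW_b > 0` and EVERY admissible displacement has positive
   ideal-wall energy; **`idealWall_window`**: the same for every wall `a < b ≤ 21/20·a` (`Λ_b` decreasing in `b`,
   lit-3 `strictAntiOn_wallFactor`); **`dWb_neg_far`**: for every `b ≥ 11/10·a`, `ξ₁` has negative ideal-wall energy;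
4. **`rwm_rate`** — in the printed regime `δW_∞ < 0 < δW_b` (`b = 21/20·a`) every `γ` with `γτ_w·δW_b = −δW_∞`,
   `τ_w > 0`, satisfies **`393/200 < γτ_w < 197/100`** (`1.965 < γτ_w < 1.970`) and `γ > 0` (`rwm_grows`).
VALIDATED (not load-bearing): float `L = 14.30462`, `Λ_∞ = 0.99669`, `Λ_b(21/20) = 6.8490`, `Λ_crit = 4.8768`,
`b_crit = 1.0714a`, `γτ_w = 1.9673` (work/preview/rwm_preview.py). Never «stable/unstable» without «MODEL M_RWM, mode
(3,1)»; nothing about a device. [instance data]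
-/

noncomputable section

open Set Filter Polynomial Literature.Analysis.ODE Literature.Analysis.FunctionSpaces
  Literature.MathematicalPhysics.MHD Literature.MathematicalPhysics.MHD.ScrewPinch
open scoped Topology

namespace Summit.Ventures.FusionMHD.Models

namespace RwmFRS1

/-! ### The reference energies of the marginal solution are the boundary form (Freidberg (11.148)) -/

/-- **(11.148) FOR `ξ₁`**: for every wall factor `Λ`, the external energy of the axis-regular marginal solution is the
boundary form: `externalEnergy 3 k 1 Λ ξ₁ = δŴ(L, Λ)·ξ₁(1)²`, `L = ξ₁′(1)/ξ₁(1)` (lit-4's (11.117)).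
[cite: Freidberg2014, §11.5.6 eq. (11.148)] -/
theorem externalEnergy_xi (Λ : ℝ) :
    P.externalEnergy 3 kk 1 Λ xi = boundaryForm (1 * deriv xi 1 / xi 1) Λ * xi 1 ^ 2 := by
  obtain ⟨hBθ, hBz, hp, hBθ0⟩ := profile_regular (51 / 50)
  have hF : ∀ r ∈ Ioc (0 : ℝ) 1, P.kDotB 3 kk r ≠ 0 := fun r hr => kDotB_ne_zero hr.1 (by nlinarith [hr.1, hr.2])
  have hODE : ∀ r ∈ Ioo (0 : ℝ) 1,
      HasDerivAt (fun s => P.newcombF 3 kk s * deriv xi s) (P.newcombG 3 kk r * xi r) r :=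
    fun r hr => xi_newcomb ⟨hr.1, by linarith [hr.2]⟩
  have hE := Profile.fluidEnergy_eq_boundary_of_solution (P := P) (m := 3) (k := kk) one_pos
    (by norm_num : (1 : ℝ) < 51 / 50) (by norm_num) hBθ hBz hp hBθ0 hF xi_contDiffOn hODE
  have hx : xi 1 ≠ 0 := xi_ne_zero 1 ⟨one_pos, le_rfl⟩
  unfold Profile.externalEnergy
  rw [hE, boundaryForm]
  unfold Profile.newcombF
  field_simp
  ring

/-- The NO-WALL reference energy `δW_∞` of the marginal solution (per `2π²R₀/μ₀`). [cite: Freidberg2014, §11.5.6 eq. (11.149)] -/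
def dWinf : ℝ := P.externalEnergy 3 kk 1 (Vacuum.wallFactorInf 3 kk 1) xi

/-- The IDEAL-WALL reference energy `δW_b` of the marginal solution, wall at `r = b`. [cite: Freidberg2014, §11.5.6 eq. (11.149)] -/
def dWb (b : ℝ) : ℝ := P.externalEnergy 3 kk 1 (Vacuum.wallFactor 3 kk 1 b) xi

/-- `ξ₁(1)² > 0`. [instance data] -/
theorem xi_one_sq_pos : 0 < xi 1 ^ 2 := by
  have := xi_pos one_pos le_rfl
  positivity

/-! ### Sentence 1: the critical wall factor -/

/-- **`Λ_crit ∈ (4.87678, 4.87679)`** (from `14.3046191 < L < 14.3046192`). [instance data] -/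
theorem lambdaCrit_bounds : (487678 / 100000 : ℝ) < lambdaCrit (1 * deriv xi 1 / xi 1) ∧
    lambdaCrit (1 * deriv xi 1 / xi 1) < (487679 / 100000 : ℝ) := by
  obtain ⟨h1, h2⟩ := L_bounds
  unfold lambdaCrit
  constructor <;> linarith

/-! ### The wall factors: `Λ_∞(1/5)` and `Λ_b` at `ζ_b = 21/100`, `11/50` (lit-3's §9 recipe, §11 template) -/

/-- `Λ(3, k, 1, b) = Λ_wall(3, 1/5, b/5)` (`|k| = 1/5`). [instance data] -/
theorem wallFactor_eq (b : ℝ) : Vacuum.wallFactor 3 kk 1 b = Vacuum.lambdaWall 3 (1 / 5) (1 / 5 * b) := by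
  rw [Vacuum.wallFactor, kk, show |(-1 / 5 : ℝ)| = 1 / 5 by norm_num, mul_one]

/-- `Λ_∞(3, k, 1) = Λ_∞(3, 1/5)`. [instance data] -/
theorem wallFactorInf_eq : Vacuum.wallFactorInf 3 kk 1 = Vacuum.lambdaInf 3 (1 / 5) := by
  rw [Vacuum.wallFactorInf, kk, show |(-1 / 5 : ℝ)| = 1 / 5 by norm_num, mul_one]

/-- **`0.99666 ≤ Λ_∞(3, 1/5) ≤ 0.9967`** (ratio form `3K₃/(3K₃ + ζK₂)` with the tree's `K₂`, `K₃` enclosures; the printed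
«`Λ_∞ ≈ 1`»). [cite: Freidberg2014, §11.5.6 eq. (11.150)] -/
theorem lambdaInf_bounds : (99666 / 100000 : ℝ) ≤ Vacuum.lambdaInf 3 (1 / 5) ∧
    Vacuum.lambdaInf 3 (1 / 5) ≤ (9967 / 10000 : ℝ) := by
  have hza : (0 : ℝ) < 1 / 5 := by norm_num
  have h := Vacuum.lambdaInf_eq_ratio 3 hza
  norm_num at h
  have hK2 := besselKReal_two_mem_Icc hza
  have hK3L := le_besselKReal_add_two 1 hza
  have hK3U := besselKReal_add_three_le 0 hza
  norm_num [Nat.factorial] at hK2 hK3L hK3U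
  obtain ⟨hK2L, hK2U⟩ := hK2
  have hK3 : 0 < besselKReal 3 (1 / 5 : ℝ) := by linarith
  have hden : 0 < 3 * besselKReal 3 (1 / 5 : ℝ) + 1 / 5 * besselKReal 2 (1 / 5) := by nlinarith
  rw [h]
  constructor
  · rw [le_div_iff₀ hden]; nlinarith
  · rw [div_le_iff₀ hden]; nlinarith

/-- **`6.847 ≤ Λ_b(3, 1/5, 21/100) ≤ 6.851`** — the wall at `b = 21/20·a` (lit-3 §9 brackets with the tree's elementary
I/K enclosures; VALIDATED float `6.8490`). [cite: Freidberg2014, §11.5.1 eq. (11.96)] -/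
theorem lambdaWall_21_bounds : (6847 / 1000 : ℝ) ≤ Vacuum.lambdaWall 3 (1 / 5) (21 / 100) ∧
    Vacuum.lambdaWall 3 (1 / 5) (21 / 100) ≤ (6851 / 1000 : ℝ) := by
  have hza : (0 : ℝ) < 1 / 5 := by norm_num
  have hzb : (0 : ℝ) < 21 / 100 := by norm_num
  have hab : (1 / 5 : ℝ) < 21 / 100 := by norm_num
  -- I-side at ζ_a = 1/5
  have i3aL := firstTwoTerms_le_besselI 3 hza.le
  have i3aU := besselI_le_firstTerm_div 3 hza.le (by norm_num)
  have i4aL := firstTwoTerms_le_besselI 4 hza.le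
  have i4aU := besselI_le_firstTerm_div 4 hza.le (by norm_num)
  have hda := mul_deriv_besselI 3 (1 / 5 : ℝ)
  norm_num [Nat.factorial] at i3aL i3aU i4aL i4aU hda
  -- I-side at ζ_b = 21/100
  have i3bL := firstTwoTerms_le_besselI 3 hzb.le
  have i3bU := besselI_le_firstTerm_div 3 hzb.le (by norm_num)
  have i4bL := firstTwoTerms_le_besselI 4 hzb.le
  have i4bU := besselI_le_firstTerm_div 4 hzb.le (by norm_num)
  have hdb := mul_deriv_besselI 3 (21 / 100 : ℝ)
  norm_num [Nat.factorial] at i3bL i3bU i4bL i4bU hdb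
  -- K-side
  have hK2a := besselKReal_two_mem_Icc hza
  have hK2b := besselKReal_two_mem_Icc hzb
  have hK3aL := le_besselKReal_add_two 1 hza
  have hK3aU := besselKReal_add_three_le 0 hza
  have hK3bL := le_besselKReal_add_two 1 hzb
  have hK3bU := besselKReal_add_three_le 0 hzb
  norm_num [Nat.factorial] at hK2a hK2b hK3aL hK3aU hK3bL hK3bU
  have hQa := Vacuum.neg_deriv_besselKReal_eq 3 hza
  have hPb := Vacuum.neg_deriv_besselKReal_eq 3 hzb
  norm_num at hQa hPb
  -- derivative forms: I₃′(z) = (3 I₃ + z I₄)/z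
  have hda' : deriv (besselI 3) (1 / 5 : ℝ) = 15 * besselI 3 (1 / 5) + besselI 4 (1 / 5) := by linarith
  have hdb' : deriv (besselI 3) (21 / 100 : ℝ) = 100 / 7 * besselI 3 (21 / 100) + besselI 4 (21 / 100) := by
    linarith
  constructor
  · have h := Vacuum.le_lambdaWall_of_bounds 3 hza hab
      (ibL := 100 / 7 * (495281367 / 2560000000000) + 12993988707 / 2560000000000000)
      (ibU := 100 / 7 * (3087 / 15955900) + 64827 / 12771776000)
      (kaL := 995) (iaL := 401 / 2400000)
      (pL := (39559 / 882) + 100 / 7 * (7955900 / 9261)) (qU := 50 + 15 * (39801 / 40))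
      (iadL := 15 * (401 / 2400000) + 167 / 40000000)
      (by rw [hdb']; linarith) (by rw [hdb']; linarith) (by linarith) (by linarith)
      (by push_cast; rw [hPb]; linarith [hK2b.1]) (by push_cast; rw [hQa]; linarith [hK2a.2])
      (by rw [hda']; linarith) (by norm_num) (by norm_num) (by norm_num) (by norm_num) (by norm_num)
    refine le_trans ?_ h
    norm_num
  · have h := Vacuum.lambdaWall_le_of_bounds 3 hza hab
      (ibL := 100 / 7 * (495281367 / 2560000000000) + 12993988707 / 2560000000000000)
      (ibU := 100 / 7 * (3087 / 15955900) + 64827 / 12771776000)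
      (kaU := 39801 / 40) (iaU := 1 / 5985)
      (pU := 20000 / 441 + 100 / 7 * (6364914481 / 7408800)) (qL := 99 / 2 + 15 * 995)
      (iadU := 15 * (1 / 5985) + 1 / 239520)
      (by rw [hdb']; linarith) (by rw [hdb']; linarith) (by linarith) (by linarith)
      (by push_cast; rw [hPb]; linarith [hK2b.2]) (by push_cast; rw [hQa]; linarith [hK2a.1])
      (by rw [hda']; linarith) (by norm_num) (by norm_num)
    refine h.trans ?_
    norm_num

/-- **`Λ_b(3, 1/5, 11/50) ≤ 3.576`** — the wall at `b = 11/10·a` (VALIDATED float `3.5751`).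
[cite: Freidberg2014, §11.5.1 eq. (11.96)] -/
theorem lambdaWall_22_le : Vacuum.lambdaWall 3 (1 / 5) (11 / 50) ≤ (3576 / 1000 : ℝ) := by
  have hza : (0 : ℝ) < 1 / 5 := by norm_num
  have hzb : (0 : ℝ) < 11 / 50 := by norm_num
  have hab : (1 / 5 : ℝ) < 11 / 50 := by norm_num
  have i3aL := firstTwoTerms_le_besselI 3 hza.le
  have i3aU := besselI_le_firstTerm_div 3 hza.le (by norm_num)
  have i4aL := firstTwoTerms_le_besselI 4 hza.le
  have i4aU := besselI_le_firstTerm_div 4 hza.le (by norm_num)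
  have hda := mul_deriv_besselI 3 (1 / 5 : ℝ)
  norm_num [Nat.factorial] at i3aL i3aU i4aL i4aU hda
  have i3bL := firstTwoTerms_le_besselI 3 hzb.le
  have i3bU := besselI_le_firstTerm_div 3 hzb.le (by norm_num)
  have i4bL := firstTwoTerms_le_besselI 4 hzb.le
  have i4bU := besselI_le_firstTerm_div 4 hzb.le (by norm_num)
  have hdb := mul_deriv_besselI 3 (11 / 50 : ℝ)
  norm_num [Nat.factorial] at i3bL i3bU i4bL i4bU hdb
  have hK2a := besselKReal_two_mem_Icc hza
  have hK2b := besselKReal_two_mem_Icc hzb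
  have hK3aL := le_besselKReal_add_two 1 hza
  have hK3aU := besselKReal_add_three_le 0 hza
  have hK3bL := le_besselKReal_add_two 1 hzb
  have hK3bU := besselKReal_add_three_le 0 hzb
  norm_num [Nat.factorial] at hK2a hK2b hK3aL hK3aU hK3bL hK3bU
  have hQa := Vacuum.neg_deriv_besselKReal_eq 3 hza
  have hPb := Vacuum.neg_deriv_besselKReal_eq 3 hzb
  norm_num at hQa hPb
  have hda' : deriv (besselI 3) (1 / 5 : ℝ) = 15 * besselI 3 (1 / 5) + besselI 4 (1 / 5) := by linarith
  have hdb' : deriv (besselI 3) (11 / 50 : ℝ) = 150 / 11 * besselI 3 (11 / 50) + besselI 4 (11 / 50) := by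
    linarith
  have h := Vacuum.lambdaWall_le_of_bounds 3 hza hab
    (ibL := 150 / 11 * (53401051 / 240000000000) + 244607187 / 40000000000000)
    (ibU := 150 / 11 * (1331 / 5981850) + 14641 / 2394192000)
    (kaU := 39801 / 40) (iaU := 1 / 5985)
    (pU := 5000 / 121 + 150 / 11 * (397594641 / 532400)) (qL := 99 / 2 + 15 * 995)
    (iadU := 15 * (1 / 5985) + 1 / 239520)
    (by rw [hdb']; linarith) (by rw [hdb']; linarith) (by linarith) (by linarith)
    (by push_cast; rw [hPb]; linarith [hK2b.2]) (by push_cast; rw [hQa]; linarith [hK2a.1])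
    (by rw [hda']; linarith) (by norm_num) (by norm_num)
  refine h.trans ?_
  norm_num

/-! ### Sentences 2–3: energies of the marginal solution and the external-mode test -/

/-- **SENTENCE 2 (no wall): `δW_∞ < 0`** — `Λ_∞ < 1 < Λ_crit`. [cite: Freidberg2014, §11.5.6 eq. (11.149), (11.151)] -/
theorem dWinf_neg : dWinf < 0 := by
  rw [dWinf, externalEnergy_xi]
  have hΛ : Vacuum.wallFactorInf 3 kk 1 < 1 :=
    Vacuum.wallFactorInf_lt_one (by norm_num) (by rw [kk]; norm_num) one_pos
  have hneg : boundaryForm (1 * deriv xi 1 / xi 1) (Vacuum.wallFactorInf 3 kk 1) < 0 := by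
    rw [boundaryForm_neg_iff]
    linarith [lambdaCrit_bounds.1]
  exact mul_neg_of_neg_of_pos hneg xi_one_sq_pos

/-- **SENTENCE 3 (ideal wall at `b = 21/20·a`): `δW_b > 0`** — `Λ_b ≥ 6.847 > Λ_crit`.
[cite: Freidberg2014, §11.5.6 eq. (11.149), (11.151)] -/
theorem dWb_pos : 0 < dWb (21 / 20) := by
  rw [dWb, externalEnergy_xi]
  have hΛ : (6847 / 1000 : ℝ) ≤ Vacuum.wallFactor 3 kk 1 (21 / 20) := by
    rw [wallFactor_eq, show (1 / 5 : ℝ) * (21 / 20) = 21 / 100 by norm_num]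
    exact lambdaWall_21_bounds.1
  have hpos : 0 < boundaryForm (1 * deriv xi 1 / xi 1) (Vacuum.wallFactor 3 kk 1 (21 / 20)) := by
    rw [boundaryForm_pos_iff]
    linarith [lambdaCrit_bounds.2]
  exact mul_pos hpos xi_one_sq_pos

/-- **Ideal wall at `b = 11/10·a`: `δW_b < 0`** — `Λ_b ≤ 3.576 < Λ_crit` (wall too far). [cite: Freidberg2014, §11.5.6 eq. (11.149)] -/
theorem dWb_neg : dWb (11 / 10) < 0 := by
  rw [dWb, externalEnergy_xi]
  have hΛ : Vacuum.wallFactor 3 kk 1 (11 / 10) ≤ (3576 / 1000 : ℝ) := by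
    rw [wallFactor_eq, show (1 / 5 : ℝ) * (11 / 10) = 11 / 50 by norm_num]
    exact lambdaWall_22_le
  have hneg : boundaryForm (1 * deriv xi 1 / xi 1) (Vacuum.wallFactor 3 kk 1 (11 / 10)) < 0 := by
    rw [boundaryForm_neg_iff]
    linarith [lambdaCrit_bounds.1]
  exact mul_neg_of_neg_of_pos hneg xi_one_sq_pos

/-- Admissible displacements of the external-mode test (lit-4): `C¹` on `(−51/50, 51/50)` and not `≡ 0` on `[0, 1]`.
[cite: Freidberg2014, §11.5.3 eq. (11.118)] -/
def IsAdmissible (ξ : ℝ → ℝ) : Prop := ContDiffOn ℝ 1 ξ (Ioo (-(51 / 50)) (51 / 50)) ∧ ∃ r ∈ Icc (0 : ℝ) 1, ξ r ≠ 0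

/-- The marginal solution `ξ₁` is admissible. [instance data] -/
theorem xi_admissible : IsAdmissible xi :=
  ⟨xi_contDiffOn, 1, ⟨zero_le_one, le_rfl⟩, xi_ne_zero 1 ⟨one_pos, le_rfl⟩⟩

/-- **NEWCOMB'S EXTERNAL-MODE TEST FOR MODEL M_RWM, MODE `(3,1)`** (lit-4's `newcombExternalModes_iff` instantiated with
the kernel solution `ξ₁`): for every wall factor `Λ`, ALL admissible displacements have positive external energy iff
`δŴ(L, Λ)·ξ₁(1)² > 0`. [cite: Freidberg2014, §11.5.3 eq. (11.118)] -/
theorem externalModes_iff (Λ : ℝ) :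
    (∀ ξ : ℝ → ℝ, IsAdmissible ξ → 0 < P.externalEnergy 3 kk 1 Λ ξ) ↔
      0 < boundaryForm (1 * deriv xi 1 / xi 1) Λ * xi 1 ^ 2 := by
  obtain ⟨hBθ, hBz, hp, hBθ0⟩ := profile_regular (51 / 50)
  have hF : ∀ r ∈ Ioc (0 : ℝ) 1, P.kDotB 3 kk r ≠ 0 := fun r hr => kDotB_ne_zero hr.1 (by nlinarith [hr.1, hr.2])
  have hODE : ∀ r ∈ Ioo (0 : ℝ) 1,
      HasDerivAt (fun s => P.newcombF 3 kk s * deriv xi s) (P.newcombG 3 kk r * xi r) r :=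
    fun r hr => xi_newcomb ⟨hr.1, by linarith [hr.2]⟩
  have h := Profile.newcombExternalModes_iff (P := P) (m := 3) (k := kk) one_pos (by norm_num : (1 : ℝ) < 51 / 50)
    (by norm_num) hBθ hBz hp hBθ0 hF xi_contDiffOn hODE xi_ne_zero Λ
  rw [boundaryForm_mul] at h
  constructor
  · intro hall
    exact h.1 fun ξ hξ hne => hall ξ ⟨hξ, hne⟩
  · intro hpos ξ hξ
    exact h.2 hpos ξ hξ.1 hξ.2

/-- **SENTENCE 2′ (no wall): NOT every admissible displacement has positive no-wall energy** — indeed `ξ₁` itself has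
`δW_∞ < 0` (the external `(3,1)` kink side of MODEL M_RWM; never «the device is unstable»).
[cite: Freidberg2014, §11.5.6 eq. (11.151)] -/
theorem noWall_not_stable :
    ¬ (∀ ξ : ℝ → ℝ, IsAdmissible ξ → 0 < P.externalEnergy 3 kk 1 (Vacuum.wallFactorInf 3 kk 1) ξ) := by
  intro hall
  have h := hall xi xi_admissible
  have h2 := dWinf_neg
  rw [dWinf] at h2
  linarith

/-- **SENTENCE 3′ (ideal wall at `b = 21/20·a`): EVERY admissible displacement has positive ideal-wall energy** in MODEL
M_RWM, mode `(3,1)` (wall-stabilised side). [cite: Freidberg2014, §11.5.6 eq. (11.151)] -/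
theorem idealWall_stable :
    ∀ ξ : ℝ → ℝ, IsAdmissible ξ → 0 < P.externalEnergy 3 kk 1 (Vacuum.wallFactor 3 kk 1 (21 / 20)) ξ := by
  have h := dWb_pos
  rw [dWb, externalEnergy_xi] at h
  exact (externalModes_iff _).2 h

/-- **THE IDEAL-WALL WINDOW**: for every DECLARED wall radius `a < b ≤ 21/20·a` all admissible displacements have positive
energy (`Λ_b` is decreasing in `b`, lit-3 `strictAntiOn_wallFactor`). [cite: Freidberg2014, §11.5.6 eq. (11.150)–(11.151)] -/
theorem idealWall_window {b : ℝ} (hb1 : 1 < b) (hb2 : b ≤ 21 / 20) :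
    ∀ ξ : ℝ → ℝ, IsAdmissible ξ → 0 < P.externalEnergy 3 kk 1 (Vacuum.wallFactor 3 kk 1 b) ξ := by
  have hk : kk ≠ 0 := by rw [kk]; norm_num
  have hmono := Vacuum.strictAntiOn_wallFactor (m := 3) (by norm_num) hk one_pos
  have hΛ : Vacuum.wallFactor 3 kk 1 (21 / 20) ≤ Vacuum.wallFactor 3 kk 1 b := by
    rcases eq_or_lt_of_le hb2 with h | h
    · rw [h]
    · exact (hmono (show (1 : ℝ) < b from hb1) (show (1 : ℝ) < 21 / 20 by norm_num) h).le
  have h21 := dWb_pos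
  rw [dWb, externalEnergy_xi] at h21
  refine (externalModes_iff _).2 ?_
  have hx := xi_one_sq_pos
  have hmonoB := (boundaryForm_strictMono (1 * deriv xi 1 / xi 1)).monotone hΛ
  have : 0 < boundaryForm (1 * deriv xi 1 / xi 1) (Vacuum.wallFactor 3 kk 1 (21 / 20)) :=
    pos_of_mul_pos_left h21 hx.le
  exact mul_pos (lt_of_lt_of_le this hmonoB) hx

/-- **Far walls do not stabilise**: for every `b ≥ 11/10·a` the marginal solution `ξ₁` has negative ideal-wall energy
(MODEL M_RWM, mode `(3,1)`). [cite: Freidberg2014, §11.5.6 eq. (11.150)] -/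
theorem dWb_neg_far {b : ℝ} (hb : 11 / 10 ≤ b) : dWb b < 0 := by
  have hk : kk ≠ 0 := by rw [kk]; norm_num
  have hmono := Vacuum.strictAntiOn_wallFactor (m := 3) (by norm_num) hk one_pos
  have hΛ : Vacuum.wallFactor 3 kk 1 b ≤ Vacuum.wallFactor 3 kk 1 (11 / 10) := by
    rcases eq_or_lt_of_le hb with h | h
    · rw [h]
    · exact (hmono (show (1 : ℝ) < 11 / 10 by norm_num) (show (1 : ℝ) < b by linarith) h).le
  have h11 := dWb_neg
  rw [dWb, externalEnergy_xi] at h11 ⊢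
  have hx := xi_one_sq_pos
  have hmonoB := (boundaryForm_strictMono (1 * deriv xi 1 / xi 1)).monotone hΛ
  have : boundaryForm (1 * deriv xi 1 / xi 1) (Vacuum.wallFactor 3 kk 1 (11 / 10)) < 0 :=
    neg_of_mul_neg_left (by linarith) hx.le
  exact mul_neg_of_neg_of_pos (lt_of_le_of_lt hmonoB this) hx

/-! ### Sentence 4: the thin-wall resistive wall mode (Freidberg (11.169)) -/

/-- **THE RWM GROWS** in MODEL M_RWM with the thin resistive wall at `b = 21/20·a`: every rate `γ` of the printed
dispersion relation `γτ_w·δW_b = −δW_∞` with `τ_w > 0` is positive. [cite: Freidberg2014, §11.5.6 eq. (11.169)] -/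
theorem rwm_grows {γ τw : ℝ} (hτ : 0 < τw) (h : ResistiveWall.IsThinWallRate dWinf (dWb (21 / 20)) τw γ) : 0 < γ :=
  h.growth_pos hτ dWinf_neg dWb_pos

/-- **SENTENCE 4: THE CERTIFIED RWM RATE `1.965 < γτ_w < 1.970`** (`b = 21/20·a`; `γτ_w = −δW_∞/δW_b
= (Λ_crit − Λ_∞)/(Λ_b − Λ_crit)` with `Λ_∞ ∈ [0.99666, 0.9967]`, `Λ_b ∈ [6.847, 6.851]`, `Λ_crit ∈ (4.87678, 4.87679)`;
VALIDATED float `1.9673`). [cite: Freidberg2014, §11.5.6 eq. (11.169)] -/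
theorem rwm_rate {γ τw : ℝ} (h : ResistiveWall.IsThinWallRate dWinf (dWb (21 / 20)) τw γ) :
    (393 / 200 : ℝ) < γ * τw ∧ γ * τw < (197 / 100 : ℝ) := by
  unfold ResistiveWall.IsThinWallRate at h
  rw [dWinf, dWb, externalEnergy_xi, externalEnergy_xi, wallFactorInf_eq, wallFactor_eq,
    show (1 / 5 : ℝ) * (21 / 20) = 21 / 100 by norm_num, boundaryForm_eq_sub, boundaryForm_eq_sub] at h
  obtain ⟨hc1, hc2⟩ := lambdaCrit_bounds
  obtain ⟨hi1, hi2⟩ := lambdaInf_bounds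
  obtain ⟨hb1, hb2⟩ := lambdaWall_21_bounds
  have hx := xi_one_sq_pos
  set Lc := lambdaCrit (1 * deriv xi 1 / xi 1) with hLc
  set Li := Vacuum.lambdaInf 3 (1 / 5) with hLi
  set Lb := Vacuum.lambdaWall 3 (1 / 5) (21 / 100) with hLb
  set X := xi 1 ^ 2 with hX
  -- `γτ_w (Λ_b − Λ_c) = Λ_c − Λ_∞`
  have key : γ * τw * (Lb - Lc) = Lc - Li := by
    have h' : γ * τw * ((Lb - Lc) / 14700 * X) = -((Li - Lc) / 14700 * X) := h
    have hX0 : X ≠ 0 := hx.ne'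
    field_simp at h'
    linarith
  have hd : 0 < Lb - Lc := by linarith
  constructor
  · by_contra hle
    rw [not_lt] at hle
    have : γ * τw * (Lb - Lc) ≤ 393 / 200 * (Lb - Lc) := mul_le_mul_of_nonneg_right hle hd.le
    nlinarith
  · by_contra hle
    rw [not_lt] at hle
    have : 197 / 100 * (Lb - Lc) ≤ γ * τw * (Lb - Lc) := mul_le_mul_of_nonneg_right hle hd.le
    nlinarith

end RwmFRS1

end Summit.Ventures.FusionMHD.Models

end
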